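import Summits.QuantumFields.YangMills.Theorems.UnitScaleTiltProp7FlatCoercivity
import Literature.MathematicalPhysics.QuantumFieldTheory.Balaban1983to89.B5Eq121Form
import HarnessLib

/-!
# Route `UnitScaleTilt`, crux K1 child «MinimiserStabilityRegPr» (stmt-QuantumFields-19200), registered stub `stub_prop7From14` (v4 828f5fb4a904d3be;
# leaf V3 «Prop 7 from a background (14)») — sub-lemma V3-D1b: THE FLAT LINEARISED WILSON HESSIAN IN HODGE FORM IS `k`-UNIFORMLY COERCIVE ON THE
# KERNEL OF THE STRAIGHT-LINE BLOCK AVERAGING — curl² + divergence² + block-average² ≥ (8/17)·L^{−2k}·‖X‖²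

Cell `ym3-torus` ∕ fleet seat `ym-ust-19200-p1` (HUMAN RULING D-0037, YM ladder rung R3).  Sequel of `UnitScaleTiltProp7FlatCoercivity` (p451004, V3-D1a):
there the `k`-uniform bound `Σ_b X(b)² ≤ 2L^{ed}Σ_c(M_eX)(c)² + (17/8)(L^e)²Σ_bΣ_ν(X(b+e_ν)−X(b))²` controls a real bond field by its straight-line
`e`-fold block averages and its full lattice GRADIENT.  The flat-background linearised Wilson Hessian is not the gradient form but the HODGE form:
the linearised plaquette variable of [Balaban1984PropagatorsI] (1.2), `(∂X)(p) = X(x,μ) + X(x+e_μ,ν) − X(x+e_ν,μ) − X(x,ν)` (`LatticeFieldCalculus.curl 1`),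
and the gauge-fixing term is the divergence `(∂^*X)(x) = Σ_μ (X(x−e_μ,μ) − X(x,μ))` (`LatticeFieldCalculus.diverg 1`).  The two are tied by the
printed identity (1.21) «⟨∂A, ∂A⟩ = Σ_μ⟨A_μ, ΔA_μ⟩ − ⟨∂^*A, ∂^*A⟩», kernel-checked on these carriers in the tree as
`B5Eq121Form.pairing_curl_eq_sum_bondPairing_grad_sub` (the flat lattice Weitzenböck identity).  This file composes the two BY NAME.

WHAT IS PROVED (sorry-free, no definition; real bond fields on any torus `T^{(i)}` of `Setup` lying `e` block levels above `T^{(i′)}`):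
* §1 `sum_grad_sq_eq_curl_add_diverg` — (1.21) unpacked at `w = c = 1`: `Σ_b Σ_ν (X(b+e_ν) − X(b))² = Σ_p (∂X)(p)² + Σ_x (∂^*X)(x)²`.
* §2 **`sum_sq_le_lineBlockAvg_add_curl_add_diverg`**: `Σ_b X(b)² ≤ 2L^{ed}·Σ_c (M_eX)(c)² + (17/8)(L^e)²·(Σ_p (∂X)(p)² + Σ_x (∂^*X)(x)²)` —
  i.e. the quadratic form of `∂^*∂ + ∂∂^* + a·M_e^*M_e` ([Balaban1984PropagatorsI] (1.69)/(1.72) with the FULL divergence in place of `∂R∂^*`)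
  is bounded below by `(8/17)(L^e)^{−2}` on bond fields (`a = (16/17)L^{e(d−2)}`), constants independent of the volume and of `e`;
  **`curl_sq_ge_of_landau_of_avg_zero`**: on the LANDAU-GAUGE fields (`∂^*X = 0`) with vanishing straight-line block averages (`M_eX = 0`),
  `Σ_p (∂X)(p)² ≥ (8/17)(L^e)^{−2}·Σ_b X(b)²` — the flat-background statement behind [Balaban1985BackgroundPropagators] Thm 3.11 for the d = 3
  route's carrier, in `L²` form and fine-lattice units; `…_T3` the instance at `Site (F.P K) 0`, `e = K − n`, `d = 3`.

WHAT THIS IS NOT.  Print's operator has `∂R(1)∂^*` with the RESIDUAL-gauge projection `R` of [Balaban1984PropagatorsI] (1.72) (the Landau condition is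
imposed only on the complement of the block-constant modes), not the full `∂∂^*`; the passage costs the Hodge argument of p. 30 (tree, abstract:
`B5Eq172HodgePositivity`) and is sub-lemma V3-D1b′ of the split card; the small-field perturbation (V3-D2), the identification of `M_e` with the
derivative of the family's (0.4)-descent (V3-D1c) and the sup-norm theory (V3-D3) are not touched.  Nothing of Bałaban's is asserted.

References: T. Bałaban, CMP 95 (1984) 17–40 [Balaban1984PropagatorsI] ((1.2) p.18, (1.21) p.21, (1.69)–(1.72) p.30, Prop. 1.1 (1.90) p.33);
CMP 99 (1985) 389–434 [Balaban1985BackgroundPropagators] (Thm 3.11 p.416); CMP 102 (1985) 277–309 [Balaban1985Variational] (Prop. 7 p.299).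
-/

noncomputable section

open scoped BigOperators

namespace Summit.QuantumFields.YangMills.Theorems.Prop7FlatCoercivity

open Literature.MathematicalPhysics.QuantumFieldTheory.Balaban1983to89
open Finset LatticeFieldCalculus B1RG242Torus
open B10StarCount (sum_pbond)

variable {P : Params} {i i' e : ℕ}

/-! ## §1 The flat lattice Weitzenböck identity, unpacked -/

/-- **[Balaban1984PropagatorsI] (1.21) at `w = c = 1`, unpacked**: the full gradient form of a real bond field is the sum of its curl form and
its divergence form, `Σ_b Σ_ν (X(b+e_ν) − X(b))² = Σ_p (∂X)(p)² + Σ_x (∂^*X)(x)²` (tree: `B5Eq121Form.pairing_curl_eq_sum_bondPairing_grad_sub`).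
[cite: Balaban1984PropagatorsI, (1.21) p.21] -/
theorem sum_grad_sq_eq_curl_add_diverg (X : VecField P i ℝ) :
    ∑ b : PBond P i, ∑ ν : Fin P.d, (X ⟨b.src.shift ν, b.dir⟩ - X b) ^ 2
      = ∑ p : Plaq P i, (curl 1 X p) ^ 2 + ∑ x : Site P i, (diverg 1 X x) ^ 2 := by
  have h := B5Eq121Form.pairing_curl_eq_sum_bondPairing_grad_sub (P := P) (j := i) 1 1 X
  simp only [one_mul] at h
  have hg : ∀ ν : Fin P.d, bondPairing 1 (grad 1 fun z => X ⟨z, ν⟩) (grad 1 fun z => X ⟨z, ν⟩)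
      = ∑ x : Site P i, ∑ μ : Fin P.d, (X ⟨x.shift μ, ν⟩ - X ⟨x, ν⟩) ^ 2 := by
    intro ν
    rw [bondPairing, sum_pbond]
    refine Finset.sum_congr rfl fun x _ => Finset.sum_congr rfl fun μ _ => ?_
    simp only [grad, PBond.tgt, smul_eq_mul, one_mul, sq]
  have hd : ∀ x : Site P i, (∑ μ : Fin P.d, pdiffAdj 1 μ (fun z => X ⟨z, μ⟩) x) = diverg 1 X x := fun x => (diverg_apply 1 X x).symm
  simp only [hg, hd] at h
  rw [sum_pbond, h]
  have e1 : ∑ x : Site P i, ∑ ν : Fin P.d, ∑ μ : Fin P.d, (X ⟨x.shift μ, ν⟩ - X ⟨x, ν⟩) ^ 2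
      = ∑ ν : Fin P.d, ∑ x : Site P i, ∑ μ : Fin P.d, (X ⟨x.shift μ, ν⟩ - X ⟨x, ν⟩) ^ 2 := Finset.sum_comm
  rw [e1]
  ring

/-! ## §2 The Hodge-form coercivity -/

/-- **FLAT HODGE-FORM COERCIVITY, `k`-UNIFORM**: for every real bond field `X` on `T^{(i)}` (`|T^{(i)}| = L^e|T^{(i′)}|` per direction),
`Σ_b X(b)² ≤ 2L^{ed}·Σ_c (M_eX)(c)² + (17/8)(L^e)²·(Σ_p (∂X)(p)² + Σ_x (∂^*X)(x)²)`, `M_e` the straight-line `e`-fold block average (written out),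
`∂` ∕ `∂^*` the unit-lattice curl ∕ divergence of `LatticeFieldCalculus` — the `L²` lower bound `(8/17)(L^e)^{−2}` for `∂^*∂ + ∂∂^* + aM_e^*M_e`.
[cite: Balaban1984PropagatorsI, Prop. 1.1 (1.90) p.33] -/
theorem sum_sq_le_lineBlockAvg_add_curl_add_diverg (h : P.sitesPerDir i = P.L ^ e * P.sitesPerDir i') (X : VecField P i ℝ) :
    ∑ b : PBond P i, X b ^ 2
      ≤ 2 * ((P.L : ℝ) ^ e) ^ P.d * ∑ c : PBond P i',
            ((((P.L : ℝ) ^ e) ^ P.d * (P.L : ℝ) ^ e)⁻¹ *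
              ∑ x ∈ univ.filter (fun x : Site P i => Site.proj i' e x = c.src),
                ∑ t ∈ range (P.L ^ e), X ⟨(fun z : Site P i => z.shift c.dir)^[t] x, c.dir⟩) ^ 2
        + (17 / 8) * ((P.L : ℝ) ^ e) ^ 2 * (∑ p : Plaq P i, (curl 1 X p) ^ 2 + ∑ x : Site P i, (diverg 1 X x) ^ 2) := by
  rw [← sum_grad_sq_eq_curl_add_diverg]
  exact sum_sq_le_lineBlockAvg_add_grad h X

/-- **LANDAU GAUGE, ZERO AVERAGES**: if `∂^*X = 0` and every straight-line `e`-fold block average of `X` vanishes, then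
`(8/17)·(L^e)^{−2}·Σ_b X(b)² ≤ Σ_p (∂X)(p)²` — the flat linearised Wilson Hessian is coercive at rate `L^{−2e}` on that subspace, uniformly in
the volume and in `e`. [cite: Balaban1984PropagatorsI, Prop. 1.1 (1.90) p.33] -/
theorem curl_sq_ge_of_landau_of_avg_zero (h : P.sitesPerDir i = P.L ^ e * P.sitesPerDir i') (X : VecField P i ℝ)
    (hdiv : ∀ x : Site P i, diverg 1 X x = 0)
    (havg : ∀ c : PBond P i', ∑ x ∈ univ.filter (fun x : Site P i => Site.proj i' e x = c.src),
      ∑ t ∈ range (P.L ^ e), X ⟨(fun z : Site P i => z.shift c.dir)^[t] x, c.dir⟩ = 0) :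
    (8 / 17) * (((P.L : ℝ) ^ e) ^ 2)⁻¹ * ∑ b : PBond P i, X b ^ 2 ≤ ∑ p : Plaq P i, (curl 1 X p) ^ 2 := by
  have hm := sum_sq_le_lineBlockAvg_add_curl_add_diverg h X
  simp only [havg, hdiv, mul_zero, sq, Finset.sum_const_zero, add_zero] at hm
  have hL : (0 : ℝ) < ((P.L : ℝ) ^ e) ^ 2 := by
    have : (0 : ℝ) < P.L := by exact_mod_cast P.L_pos
    positivity
  rw [show (8 / 17 : ℝ) * (((P.L : ℝ) ^ e) ^ 2)⁻¹ * ∑ b : PBond P i, X b ^ 2 = ((8 / 17) * ∑ b : PBond P i, X b ^ 2) / ((P.L : ℝ) ^ e) ^ 2 by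
    field_simp]
  rw [div_le_iff₀ hL]
  have : ∑ b : PBond P i, X b ^ 2 = ∑ b : PBond P i, X b * X b := Finset.sum_congr rfl fun b _ => sq _
  rw [this]
  have hsq : ∑ p : Plaq P i, curl 1 X p ^ 2 = ∑ p : Plaq P i, curl 1 X p * curl 1 X p := Finset.sum_congr rfl fun p _ => sq _
  rw [hsq]
  nlinarith [hm]

/-! ## §3 At the carrier of the T³ family -/

/-- **THE HODGE-FORM FLAT COERCIVITY AT THE d = 3 CARRIER** (`Site (F.P K) 0`, `e = K − n` levels down to the comparison lattice): in the Landau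
gauge with vanishing straight-line block averages, `(8/17)L^{−2(K−n)}·Σ_b X(b)² ≤ Σ_p (∂X)(p)²`, uniformly in `m`, `n`, `K`.
[cite: Balaban1984PropagatorsI, Prop. 1.1 (1.90) p.33] -/
theorem curl_sq_ge_of_landau_of_avg_zero_T3 (F : T3ContinuumYM3Torus.T3Family) (n K : ℕ) (X : VecField (F.P K) 0 ℝ)
    (hdiv : ∀ x : Site (F.P K) 0, diverg 1 X x = 0)
    (havg : ∀ c : PBond (F.P K) (K - n), ∑ x ∈ univ.filter (fun x : Site (F.P K) 0 => Site.proj (K - n) (K - n) x = c.src),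
      ∑ t ∈ range ((F.P K).L ^ (K - n)), X ⟨(fun z : Site (F.P K) 0 => z.shift c.dir)^[t] x, c.dir⟩ = 0) :
    (8 / 17) * (((F.L : ℝ) ^ (K - n)) ^ 2)⁻¹ * ∑ b : PBond (F.P K) 0, X b ^ 2 ≤ ∑ p : Plaq (F.P K) 0, (curl 1 X p) ^ 2 :=
  curl_sq_ge_of_landau_of_avg_zero (sitesPerDir_T3 F n K) X hdiv havg

end Summit.QuantumFields.YangMills.Theorems.Prop7FlatCoercivity

end
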